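import Literature.AnabelianGeometry.SemiGraphs.TemperedAnabelianThm68OriginClosers
import Mathlib.FieldTheory.Galois.Infinite

/-!
# [SemiAnbd] Thm. 6.8 (i), morphism half ⟸ Thm. 6.4: the tempered-π₁ functor is bijective on Hom-sets

Mochizuki, *Semi-graphs of anabelioids*, Publ. RIMS **42** (2006) [SemiAnbd], §6, Theorem 6.8 (i)
(ms. p. 74) with printed proof p. 75: "In light of Theorems 6.4, 6.5, the present Theorem 6.8 follows
by exactly the same arguments as those applied in [Mzk8] to prove [Mzk8], Theorem 2.3 …", and [Mzk8]
= *Galois sections in absolute anabelian geometry*, Nagoya Math. J. **179** (2005) [GalSect], proof of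
Thm. 2.3 (ms. p. 9): "assertion (i) follows formally from Theorem 1.2" — the tempered rôle of [Mzk8]
Thm. 1.2 being [SemiAnbd] Thm. 6.4 (pp. 70–71).  The categories: [GalSect] p. 7, "by stipulating that
all schemes appearing in the definition of the category `DLoc(X_K)` … be equipped with `K`-structures
… and that all morphisms be `K`-morphisms, we obtain a category `DLoc_K(X_K)` together with a natural
faithful functor `DLoc_K(X_K) → DLoc(X_K)`" (objects: hyperbolic partial compactifications of finite
étale coverings `Y → X_K`, "`Y` a hyperbolic curve over some field [which is necessarily a finite
separable extension of `K`]"; morphisms of `DLoc(X_K)`: dominant morphisms of schemes `Z → Z'`), and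
[SemiAnbd] pp. 73–74 (morphisms of `DLoc_{G_K}(Π^temp_{X_K})`: outer homomorphisms of DOF-type
"compatible with the various natural [open] outer homomorphisms from the `Hᵢ`, `Jᵢ` to `G_K`").
[cite: MochizukiSemiAnbd2006, Thm 6.8(i) pp.74-75] [cite: MochizukiGalSect2005, Thm 2.3 p.9]
[cite: MochizukiGalSect2005, Def 2.1 p.7]

PROOF-ONLY file (no definitions, no new named facts; abc-iut cell, layer L3, D-0079 L-F pack D,
[SemiAnbd] §6).  In the Thm. 6.8 reduction closers of record (`TemperedAnabelianThm68OriginClosers.lean`)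
the MORPHISM HALF of Thm. 6.8 (i) — sub-DAG node T68i-L04 `Thm68Sub.PiFunctorBijectiveOnHom X D`, "the
tempered fundamental group functor `DLoc_K(X_K) → DLoc_{G_K}(Π^temp_{X_K})` is bijective on every
Hom-set" — is a FREE binder (`hL04`).  This file DERIVES it in the kernel, for a scheme-side datum
`D : DLocSchemeData X`, from

* [SemiAnbd] Thm. 6.4 AS TYPED (`TemperedAnabelianTheorem C`) for a Thm.-6.4 datum `C` on each pair of
  curves `(D.curve Z, D.curve Z')` underlying two objects (its uniqueness clause gives injectivity, its
  existence clause surjectivity), and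
* the `K`-MORPHISM DICTIONARY between `DLoc_K(X_K)` and the Thm.-6.4 data, displayed as hypotheses
  (scheme side; [GalSect] p. 7): an injection `ι : (Z ⟶ Z') ↪ C.DomHom` ("natural faithful functor
  `DLoc_K(X_K) → DLoc(X_K)`") along which `D.pi1 = C.pi1` (one tempered-π₁ functor); the range law "a
  dominant morphism `Z → Z'` whose induced homomorphism `Π^temp_Z → Π^temp_{Z'}` is compatible with the
  outer homomorphisms to `G_K` — up to an inner automorphism of `G_K` — is a `K`-morphism" (at genuine
  data: the definition of `DLoc_K` together with the slimness of `G_K`, [AbsAnab] Thm. 1.1.1 (ii)); the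
  identifications `J_Z ≅ Π^temp_Z` of `D` lie over `G_K`; and `K ⊆ K_Z` ("over some field which is
  necessarily a finite separable extension of `K`").

Then the ORIGIN-LEVEL form `TemperedMorphismOrigin.piFunctorBijectiveOnHom_of_temperedAnabelianTheoremHolds`
— conclusion LITERALLY the binder `hL04` of the closers of record — from [SemiAnbd] Thm. 6.4 as printed
over the origin (`TemperedMorphismOrigin.TemperedAnabelianTheoremHolds`, FACT-LIST F-1693, BY NAME) and the
dictionary at certified data, and the re-knit closers for Thm. 6.8 (i)(ii)
(`…dlocGroupTheoreticityGenuineHolds_of_parts_of_thm64`, `…dlocGroupTheoreticityHolds_of_parts_of_thm64`: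
the closers of record with `hL04` REPLACED by F-1693 + the dictionary).  Tools reused BY NAME:
`DLocSchemeData.map_objIso`, `DLocObj.HomRep.compat`, `Thm68Sub.exists_conj_of_homMk_eq`,
`IsDOFTypeHom.comp`, `isDOFTypeHom_of_continuousMulEquiv`, `TemperedCurve.range_aug`, Mathlib's Galois
correspondence for `K̄/ℚ_p` (`InfiniteGalois.fixedField_fixingSubgroup`).  Honest framing: derived from
a named leaf ≠ proved in print — Thm. 6.4 stays an assumption LABEL on OUR typed statements (itself
REDUCED to named leaves elsewhere in the tree); nothing of [SemiAnbd] §6 / [GalSect] is discharged here;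
no statement is strengthened; nothing here takes a side on [IUTchIII] Cor. 3.12.
-/

noncomputable section

namespace Literature.AnabelianGeometry.SemiGraphs

open scoped Pointwise
open CategoryTheory Topology

variable {p : ℕ} [Fact p.Prime]

/-! ### Galois-correspondence plumbing inside `G_{ℚ_p}` -/

/-- If `g · G_E · g⁻¹ ⊆ G_{E'}` inside `G_{ℚ_p}` (absolute Galois groups of two subfields `E`, `E'` of
`K̄`), then `g⁻¹(E') ⊆ E`: the Galois correspondence of `K̄/ℚ_p` (`E` is the fixed field of `G_E`,
Mathlib `InfiniteGalois.fixedField_fixingSubgroup`).  Used to read the embedding of base fields off the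
Galois square of a homomorphism of tempered fundamental groups ([SemiAnbd] Thm. 6.4, p. 70: "`G_K → G_L`
… an open immersion which arises from an embedding of fields `L ↪ K`").
[cite: MochizukiSemiAnbd2006, Thm 6.4 pp.70-71] -/
theorem intermediateField_map_inv_le_of_conj_fixingSubgroup
    (E E' : IntermediateField ℚ_[p] (AlgebraicClosure ℚ_[p])) (g : GQp p)
    (h : ∀ σ ∈ E.fixingSubgroup, g * σ * g⁻¹ ∈ E'.fixingSubgroup) :
    IntermediateField.map ((g⁻¹ : GQp p) : AlgebraicClosure ℚ_[p] →ₐ[ℚ_[p]] AlgebraicClosure ℚ_[p])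
      E' ≤ E := by
  haveI : IsGalois ℚ_[p] (AlgebraicClosure ℚ_[p]) := {}
  intro w hw
  rw [IntermediateField.mem_map] at hw
  obtain ⟨z, hz, rfl⟩ := hw
  rw [← InfiniteGalois.fixedField_fixingSubgroup E, IntermediateField.mem_fixedField_iff]
  intro σ hσ
  have hfix : (g * σ * g⁻¹) z = z :=
    (IntermediateField.mem_fixingSubgroup_iff _ _).1 (h σ hσ) z hz
  change σ ((g⁻¹ : GQp p) z) = (g⁻¹ : GQp p) z
  have h1 : σ ((g⁻¹ : GQp p) z) = (g⁻¹ : GQp p) ((g * σ * g⁻¹) z) := by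
    simp only [AlgEquiv.mul_apply]
    rw [← AlgEquiv.mul_apply g⁻¹ g, inv_mul_cancel, AlgEquiv.one_apply]
  rw [h1, hfix]

namespace Thm68Sub

variable {X : TemperedCurve p}

/-! ### Injectivity on a Hom-set ⟸ the uniqueness clause of Thm. 6.4 -/

/-- **T68i-L04, injectivity half, from Thm. 6.4** ([GalSect] p. 9 "assertion (i) follows formally from
Theorem 1.2"; tempered rôle [SemiAnbd] Thm. 6.4, uniqueness clause "`π₁(f)`, `π₁(f')` define the same
outer homomorphism only if `f = f'`"): for objects `Z`, `Z'` of `DLoc_K(X_K)`, a Thm.-6.4 datum `C` on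
the underlying curves with an INJECTION `ι : (Z ⟶ Z') ↪ C.DomHom` (the faithful functor
`DLoc_K(X_K) → DLoc(X_K)`, [GalSect] p. 7) along which `C.pi1 = D.pi1`, the functor is injective on
`Hom(Z, Z')`: equal images have representatives conjugate in `J_{Z'}` (`map_objIso`), hence `π₁(ι f₁)`,
`π₁(ι f₂)` are conjugate in `Π^temp_{Z'}` after the identifications `J ≅ Π^temp`.
[cite: MochizukiSemiAnbd2006, Thm 6.8(i) p.74] [cite: MochizukiGalSect2005, Thm 2.3 p.9] -/
theorem piFunctor_map_injective_of_thm64 (D : DLocSchemeData X) {Z Z' : D.DLocK}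
    (C : TemperedCurveHom p (D.curve Z) (D.curve Z'))
    (ι : (letI := D.catK; Z ⟶ Z') → C.DomHom) (hι : Function.Injective ι)
    (hpi : letI := D.catK; ∀ f : Z ⟶ Z', C.pi1 (ι f) = D.pi1 f)
    (huniq : ∀ f f' : C.DomHom,
      (∃ y : (D.curve Z').PiTemp, ∀ x, C.pi1 f' x = y * C.pi1 f x * y⁻¹) → f = f') :
    letI := D.catK; letI := DLocObj.dlocCategory X
    Function.Injective (fun f : Z ⟶ Z' => D.pi1Functor.map f) := by
  letI := D.catK; letI := DLocObj.dlocCategory X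
  intro f₁ f₂ heq
  obtain ⟨φ₁, hφ₁, c₁, hc₁⟩ := D.map_objIso f₁
  obtain ⟨φ₂, hφ₂, c₂, hc₂⟩ := D.map_objIso f₂
  have h12 : (DLocObj.homMk φ₁ : D.pi1Functor.obj Z ⟶ D.pi1Functor.obj Z') = DLocObj.homMk φ₂ := by
    rw [← hφ₁, ← hφ₂]; exact heq
  obtain ⟨b, hb⟩ := exists_conj_of_homMk_eq h12
  refine hι (huniq (ι f₁) (ι f₂) ⟨c₂⁻¹ * D.objIso Z' b * c₁, fun x => ?_⟩)
  rw [hpi, hpi]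
  obtain ⟨j, rfl⟩ : ∃ j, D.objIso Z j = x := ⟨(D.objIso Z).symm x, by simp⟩
  have e2 : D.pi1 f₂ (D.objIso Z j) = c₂⁻¹ * D.objIso Z' (φ₂.toHom j) * c₂ := by
    rw [hc₂ j]; group
  rw [e2, hb j, map_mul, map_mul, map_inv, hc₁ j]
  group

/-! ### Surjectivity on a Hom-set ⟸ the existence clause of Thm. 6.4 + the `K`-morphism dictionary -/

/-- **The Galois square of a transported representative.**  For a representative `φ : J_Z → J_{Z'}` of a
morphism of `DLoc_{G_K}(Π^temp_{X_K})` (compatible with the outer homomorphisms to `G_K` up to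
`Inn(g)`, `g ∈ G_K`, [SemiAnbd] p. 74) and identifications `J ≅ Π^temp` lying over `G_K`, the
transported homomorphism `ψ = (J_{Z'} ≅ Π^temp_{Z'}) ∘ φ ∘ (Π^temp_Z ≅ J_Z)` satisfies
`(Π^temp_{Z'} → G_{ℚ_p}) ∘ ψ = Inn(g) ∘ (Π^temp_Z → G_{ℚ_p})`. [cite: MochizukiSemiAnbd2006, §6 p.74] -/
theorem aug_transportedRep (D : DLocSchemeData X) {Z Z' : D.DLocK}
    (haug : letI := D.catK; letI := DLocObj.dlocCategory X;
      ∀ j, (D.curve Z).aug (D.objIso Z j) = (D.pi1Functor.obj Z).augJ j)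
    (haug' : letI := D.catK; letI := DLocObj.dlocCategory X;
      ∀ j, (D.curve Z').aug (D.objIso Z' j) = (D.pi1Functor.obj Z').augJ j)
    (φ : letI := D.catK; letI := DLocObj.dlocCategory X;
      DLocObj.HomRep (D.pi1Functor.obj Z) (D.pi1Functor.obj Z'))
    (g : GQp p)
    (hg : letI := D.catK; letI := DLocObj.dlocCategory X;
      ∀ j, (D.pi1Functor.obj Z').augJ (φ.toHom j) = g * (D.pi1Functor.obj Z).augJ j * g⁻¹)
    (x : (D.curve Z).PiTemp) :
    (D.curve Z').aug (D.objIso Z' (φ.toHom ((D.objIso Z).symm x))) = g * (D.curve Z).aug x * g⁻¹ := by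
  letI := D.catK; letI := DLocObj.dlocCategory X
  rw [haug', hg, ← haug, ContinuousMulEquiv.apply_symm_apply]

/-- **The transported representative is a Thm.-6.4 homomorphism** ([SemiAnbd] Thm. 6.4, p. 70: "of
DOF-type … fit into a commutative diagram [over] `G_K → G_L` … an open immersion which arises from an
embedding of fields `L ↪ K`"): `ψ = (J_{Z'} ≅ Π^temp_{Z'}) ∘ φ ∘ (Π^temp_Z ≅ J_Z)` is of DOF-type
(`IsDOFTypeHom.comp`, isomorphisms being of DOF-type) and lies over `G_{K_Z} → G_{K_{Z'}}`,
`h ↦ g h g⁻¹`, with `g⁻¹(K_{Z'}) ⊆ K_Z` — the field inclusion read off `g · G_{K_Z} · g⁻¹ ⊆ G_{K_{Z'}}`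
(images of the augmentations, `range_aug`) by the Galois correspondence of `K̄/ℚ_p`.
[cite: MochizukiSemiAnbd2006, Thm 6.4 pp.70-71] -/
theorem isGaloisCompatibleDOFHom_transportedRep (D : DLocSchemeData X) {Z Z' : D.DLocK}
    (haug : letI := D.catK; letI := DLocObj.dlocCategory X;
      ∀ j, (D.curve Z).aug (D.objIso Z j) = (D.pi1Functor.obj Z).augJ j)
    (haug' : letI := D.catK; letI := DLocObj.dlocCategory X;
      ∀ j, (D.curve Z').aug (D.objIso Z' j) = (D.pi1Functor.obj Z').augJ j)
    (φ : letI := D.catK; letI := DLocObj.dlocCategory X;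
      DLocObj.HomRep (D.pi1Functor.obj Z) (D.pi1Functor.obj Z'))
    (g : GQp p)
    (hg : letI := D.catK; letI := DLocObj.dlocCategory X;
      ∀ j, (D.pi1Functor.obj Z').augJ (φ.toHom j) = g * (D.pi1Functor.obj Z).augJ j * g⁻¹) :
    IsGaloisCompatibleDOFHom (D.curve Z) (D.curve Z')
      (((D.objIso Z' : _ →ₜ* (D.curve Z').PiTemp).comp φ.toHom).comp
        ((D.objIso Z).symm : (D.curve Z).PiTemp →ₜ* _)) := by
  letI := D.catK; letI := DLocObj.dlocCategory X
  have happ : ∀ x, (((D.objIso Z' : _ →ₜ* (D.curve Z').PiTemp).comp φ.toHom).comp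
      ((D.objIso Z).symm : (D.curve Z).PiTemp →ₜ* _)) x =
        D.objIso Z' (φ.toHom ((D.objIso Z).symm x)) := fun x => rfl
  refine ⟨?_, g⁻¹, ?_, fun x => ?_⟩
  · exact ((isDOFTypeHom_of_continuousMulEquiv (D.objIso Z')).comp φ.isDOFTypeHom).comp
      (isDOFTypeHom_of_continuousMulEquiv (D.objIso Z).symm)
  · refine intermediateField_map_inv_le_of_conj_fixingSubgroup _ _ g fun σ hσ => ?_
    have hσ' : σ ∈ (D.curve Z).aug.toMonoidHom.range := by rw [(D.curve Z).range_aug]; exact hσ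
    obtain ⟨x₀, rfl⟩ := hσ'
    rw [← (D.curve Z').range_aug]
    refine ⟨D.objIso Z' (φ.toHom ((D.objIso Z).symm x₀)), ?_⟩
    change (D.curve Z').aug _ = g * (D.curve Z).aug x₀ * g⁻¹
    exact aug_transportedRep D haug haug' φ g hg x₀
  · rw [happ, inv_inv]
    exact aug_transportedRep D haug haug' φ g hg x

/-- **T68i-L04, surjectivity half, from Thm. 6.4** ([GalSect] p. 9 "assertion (i) follows formally
from Theorem 1.2"; tempered rôle [SemiAnbd] Thm. 6.4, existence clause "every `φ` satisfying [the
condition] is, up to an inner automorphism of `Π^temp_{Y_L}`, some `π₁(f)`"): a morphism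
`(Π^temp_Y ↠ Π^temp_Z) → (Π^temp_{Y'} ↠ Π^temp_{Z'})` of `DLoc_{G_K}(Π^temp_{X_K})` is represented by
an outer homomorphism `J_Z → J_{Z'}` of DOF-type over `G_K`; transported along `J ≅ Π^temp` it is a
Thm.-6.4 homomorphism `Π^temp_Z → Π^temp_{Z'}` (`isGaloisCompatibleDOFHom_transportedRep`), hence
`π₁(f)` up to `Π^temp_{Z'}`-conjugation for a dominant morphism `f : Z → Z'` (Thm. 6.4); `π₁(f)` is
then compatible with the outer homomorphisms to `G_K` up to `Inn(aug(y)·g)`, `aug(y) ∈ G_{K_{Z'}} ⊆ G_K`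
(`K ⊆ K_{Z'}`), so `f` is a `K`-morphism `f₀ : Z ⟶ Z'` by the range law of the dictionary, and the
functor sends `f₀` to the class of `φ` (`map_objIso`: both representatives agree up to `J_{Z'}`-conjugation).
[cite: MochizukiSemiAnbd2006, Thm 6.8(i) p.74] [cite: MochizukiGalSect2005, Thm 2.3 p.9] -/
theorem piFunctor_map_surjective_of_thm64 (D : DLocSchemeData X) {Z Z' : D.DLocK}
    (C : TemperedCurveHom p (D.curve Z) (D.curve Z'))
    (ι : (letI := D.catK; Z ⟶ Z') → C.DomHom)
    (hpi : letI := D.catK; ∀ f : Z ⟶ Z', C.pi1 (ι f) = D.pi1 f)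
    (hrange : ∀ f : C.DomHom, (∃ g ∈ X.GK, ∀ x : (D.curve Z).PiTemp,
        (D.curve Z').aug (C.pi1 f x) = g * (D.curve Z).aug x * g⁻¹) → f ∈ Set.range ι)
    (hK' : X.K ≤ (D.curve Z').K)
    (haug : letI := D.catK; letI := DLocObj.dlocCategory X;
      ∀ j, (D.curve Z).aug (D.objIso Z j) = (D.pi1Functor.obj Z).augJ j)
    (haug' : letI := D.catK; letI := DLocObj.dlocCategory X;
      ∀ j, (D.curve Z').aug (D.objIso Z' j) = (D.pi1Functor.obj Z').augJ j)
    (hexist : ∀ ψ : (D.curve Z).PiTemp →ₜ* (D.curve Z').PiTemp,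
      IsGaloisCompatibleDOFHom (D.curve Z) (D.curve Z') ψ →
        ∃ f : C.DomHom, ∃ y : (D.curve Z').PiTemp, ∀ x, C.pi1 f x = y * ψ x * y⁻¹) :
    letI := D.catK; letI := DLocObj.dlocCategory X
    Function.Surjective (fun f : Z ⟶ Z' => D.pi1Functor.map f) := by
  letI := D.catK; letI := DLocObj.dlocCategory X
  intro m
  obtain ⟨φ, hφm⟩ := Quotient.exists_rep m
  obtain ⟨g, hgK, hg⟩ := φ.compat
  -- the transported homomorphism `ψ : Π^temp_Z → Π^temp_{Z'}` is a Thm.-6.4 homomorphism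
  have hGC := isGaloisCompatibleDOFHom_transportedRep D haug haug' φ g hg
  obtain ⟨f, y, hf⟩ := hexist _ hGC
  have hf' : ∀ x, C.pi1 f x = y * D.objIso Z' (φ.toHom ((D.objIso Z).symm x)) * y⁻¹ :=
    fun x => hf x
  -- `f` is a `K`-morphism: `π₁(f)` is compatible with the outer homomorphisms to `G_K`
  have hfK : f ∈ Set.range ι := by
    refine hrange f ⟨(D.curve Z').aug y * g, X.GK.mul_mem ?_ hgK, fun x => ?_⟩
    · have hy : (D.curve Z').aug y ∈ (D.curve Z').K.fixingSubgroup := by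
        rw [← (D.curve Z').range_aug]; exact ⟨y, rfl⟩
      exact IntermediateField.fixingSubgroup_le hK' hy
    · rw [hf' x, map_mul, map_mul, map_inv, aug_transportedRep D haug haug' φ g hg x]
      group
  obtain ⟨f₀, rfl⟩ := hfK
  refine ⟨f₀, ?_⟩
  -- the functor sends `f₀` to the class of `φ`
  obtain ⟨φ₀, hφ₀, c, hc⟩ := D.map_objIso f₀
  change D.pi1Functor.map f₀ = m
  rw [hφ₀, ← hφm]
  refine Quotient.sound ⟨((D.objIso Z').symm (c * y))⁻¹, fun j => ?_⟩
  apply (D.objIso Z').injective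
  have hcj : D.objIso Z' (φ₀.toHom j) = c * (y * D.objIso Z' (φ.toHom j) * y⁻¹) * c⁻¹ := by
    rw [hc j, ← hpi f₀, hf' (D.objIso Z j), ContinuousMulEquiv.symm_apply_apply]
  simp only [map_mul, map_inv, inv_inv, ContinuousMulEquiv.apply_symm_apply]
  rw [hcj]
  group

/-! ### T68i-L04 from Thm. 6.4 for the pairs of objects -/

/-- **T68i-L04 `PiFunctorBijectiveOnHom` DERIVED from [SemiAnbd] Thm. 6.4** — the kernel form of
[GalSect] p. 9 "assertion (i) follows formally from Theorem 1.2" (morphism half; tempered rôle of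
Thm. 1.2 = [SemiAnbd] Thm. 6.4, per [SemiAnbd] p. 75): for a scheme-side datum `D` of `X_K`, Thm. 6.4
AS TYPED (`TemperedAnabelianTheorem (C Z Z')`) for a Thm.-6.4 datum on each pair of curves underlying
two objects, together with the `K`-morphism dictionary ([GalSect] p. 7) — `ι` injective ("natural
faithful functor `DLoc_K(X_K) → DLoc(X_K)`"), `C.pi1 ∘ ι = D.pi1`, the range law (`K`-morphisms =
dominant morphisms whose `π₁^temp` is compatible with the outer homomorphisms to `G_K`), the
identifications `J_Z ≅ Π^temp_Z` over `G_K`, and `K ⊆ K_Z` — imply that the tempered fundamental group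
functor `DLoc_K(X_K) → DLoc_{G_K}(Π^temp_{X_K})` is bijective on every Hom-set.
[cite: MochizukiSemiAnbd2006, Thm 6.8(i) pp.74-75] [cite: MochizukiGalSect2005, Thm 2.3 p.9] -/
theorem piFunctorBijectiveOnHom_of_temperedAnabelianTheorem (D : DLocSchemeData X)
    (C : ∀ Z Z' : D.DLocK, TemperedCurveHom p (D.curve Z) (D.curve Z'))
    (ι : letI := D.catK; ∀ Z Z' : D.DLocK, (Z ⟶ Z') → (C Z Z').DomHom)
    (hι : ∀ Z Z' : D.DLocK, Function.Injective (ι Z Z'))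
    (hpi : letI := D.catK; ∀ (Z Z' : D.DLocK) (f : Z ⟶ Z'), (C Z Z').pi1 (ι Z Z' f) = D.pi1 f)
    (hrange : ∀ (Z Z' : D.DLocK) (f : (C Z Z').DomHom),
      (∃ g ∈ X.GK, ∀ x, (D.curve Z').aug ((C Z Z').pi1 f x) = g * (D.curve Z).aug x * g⁻¹) →
        f ∈ Set.range (ι Z Z'))
    (hK : ∀ Z : D.DLocK, X.K ≤ (D.curve Z).K)
    (haug : letI := D.catK; letI := DLocObj.dlocCategory X;
      ∀ (Z : D.DLocK) (j : (D.pi1Functor.obj Z).J),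
        (D.curve Z).aug (D.objIso Z j) = (D.pi1Functor.obj Z).augJ j)
    (h64 : ∀ Z Z' : D.DLocK, TemperedAnabelianTheorem (C Z Z')) :
    PiFunctorBijectiveOnHom X D := by
  letI := D.catK; letI := DLocObj.dlocCategory X
  intro Z Z'
  exact ⟨piFunctor_map_injective_of_thm64 D (C Z Z') (ι Z Z') (hι Z Z') (hpi Z Z') (h64 Z Z').2.2,
    piFunctor_map_surjective_of_thm64 D (C Z Z') (ι Z Z') (hpi Z Z') (hrange Z Z') (hK Z')
      (haug Z) (haug Z') (h64 Z Z').2.1⟩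

end Thm68Sub

/-! ### Origin level: the binder `hL04` of the Thm. 6.8 closers from Thm. 6.4 as printed (F-1693) -/

namespace TemperedMorphismOrigin

open Thm68Sub

/-- **T68i-L04 over the origin hypotheses, from [SemiAnbd] Thm. 6.4 as printed** (F-1693
`TemperedAnabelianTheoremHolds`, BY NAME) and the `K`-morphism dictionary at CERTIFIED data: for an
origin `Ω` such that Thm. 6.4 holds for all certified data, the curves underlying the objects of a
certified `DLoc_K(X_K)` are certified hyperbolic curves over extensions of `K` ([GalSect] Def. p. 7),
the identifications `J_Z ≅ Π^temp_Z` lie over `G_K`, and every pair of objects carries a CERTIFIED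
Thm.-6.4 datum with the dictionary (`ι` injective, `C.pi1 ∘ ι = D.pi1`, range law) — the tempered-π₁
functor of every certified `DLoc_K(X_K)` is bijective on Hom-sets.  The conclusion is LITERALLY the
binder `hL04` of `dlocGroupTheoreticityGenuineHolds_of_parts` / `decompositionPreservationHolds_of_parts`
/ `torsionPointsHolds_of_parts`. [cite: MochizukiSemiAnbd2006, Thm 6.8(i) pp.74-75]
[cite: MochizukiGalSect2005, Thm 2.3 p.9] -/
theorem piFunctorBijectiveOnHom_of_temperedAnabelianTheoremHolds (Ω : TemperedMorphismOrigin p)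
    (h64 : Ω.TemperedAnabelianTheoremHolds)
    (hcurve : ∀ (X : TemperedCurve p) (D : DLocSchemeData X) (Z : D.DLocK),
      Ω.IsHyperbolicCurveOrigin X → Ω.IsDLocOrigin D.toDLocContext →
        Ω.IsHyperbolicCurveOrigin (D.curve Z))
    (hK : ∀ (X : TemperedCurve p) (D : DLocSchemeData X) (Z : D.DLocK),
      Ω.IsHyperbolicCurveOrigin X → Ω.IsDLocOrigin D.toDLocContext → X.K ≤ (D.curve Z).K)
    (haug : ∀ (X : TemperedCurve p) (D : DLocSchemeData X), Ω.IsHyperbolicCurveOrigin X →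
      Ω.IsDLocOrigin D.toDLocContext → letI := D.catK; letI := DLocObj.dlocCategory X;
        ∀ (Z : D.DLocK) (j : (D.pi1Functor.obj Z).J),
          (D.curve Z).aug (D.objIso Z j) = (D.pi1Functor.obj Z).augJ j)
    (hdict : ∀ (X : TemperedCurve p) (D : DLocSchemeData X), Ω.IsHyperbolicCurveOrigin X →
      Ω.IsDLocOrigin D.toDLocContext → letI := D.catK; ∀ Z Z' : D.DLocK,
        ∃ (C : TemperedCurveHom p (D.curve Z) (D.curve Z')) (ι : (Z ⟶ Z') → C.DomHom),
          Ω.IsDomHomOrigin C ∧ Function.Injective ι ∧ (∀ f : Z ⟶ Z', C.pi1 (ι f) = D.pi1 f) ∧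
            ∀ f : C.DomHom, (∃ g ∈ X.GK, ∀ x,
              (D.curve Z').aug (C.pi1 f x) = g * (D.curve Z).aug x * g⁻¹) → f ∈ Set.range ι) :
    ∀ (X : TemperedCurve p) (D : DLocSchemeData X), Ω.IsHyperbolicCurveOrigin X →
      Ω.IsDLocOrigin D.toDLocContext → PiFunctorBijectiveOnHom X D := by
  intro X D hX hD
  letI := D.catK; letI := DLocObj.dlocCategory X
  choose C ι hC hι hpi hrange using hdict X D hX hD
  exact piFunctorBijectiveOnHom_of_temperedAnabelianTheorem D C ι hι hpi hrange
    (fun Z => hK X D Z hX hD) (haug X D hX hD)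
    fun Z Z' => h64 _ _ (C Z Z') (hcurve X D Z hX hD) (hcurve X D Z' hX hD) (hC Z Z')

/-- **[SemiAnbd] Thm. 6.8 (i)(ii), genuine-morphism form (F-1698), REDUCED to named leaves WITH THE
MORPHISM HALF DERIVED FROM Thm. 6.4**: the closer of record `dlocGroupTheoreticityGenuineHolds_of_parts`
with its binder `hL04` (T68i-L04) REPLACED by [SemiAnbd] Thm. 6.4 as printed (F-1693, BY NAME) + the
`K`-morphism dictionary at certified data (`piFunctorBijectiveOnHom_of_temperedAnabelianTheoremHolds`).
Remaining leaves: origin closure (`hcurve`, `hK`, `haug`, `hdict`), T68i-L02, T68-B4, T68-B1, Thm. 6.5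
(iii) and (i)(ii)(iv) as printed, (hΔ), and Thm. 6.4 as printed.  Nothing of [SemiAnbd]/[GalSect] is
asserted. [cite: MochizukiSemiAnbd2006, Thm 6.8(i)-(ii) pp.74-75] [cite: MochizukiGalSect2005, Thm 2.3 p.9] -/
theorem dlocGroupTheoreticityGenuineHolds_of_parts_of_thm64 (Ω : TemperedMorphismOrigin p)
    (h64 : Ω.TemperedAnabelianTheoremHolds)
    (hcurve : ∀ (X : TemperedCurve p) (D : DLocSchemeData X) (Z : D.DLocK),
      Ω.IsHyperbolicCurveOrigin X → Ω.IsDLocOrigin D.toDLocContext →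
        Ω.IsHyperbolicCurveOrigin (D.curve Z))
    (hK : ∀ (X : TemperedCurve p) (D : DLocSchemeData X) (Z : D.DLocK),
      Ω.IsHyperbolicCurveOrigin X → Ω.IsDLocOrigin D.toDLocContext → X.K ≤ (D.curve Z).K)
    (haug : ∀ (X : TemperedCurve p) (D : DLocSchemeData X), Ω.IsHyperbolicCurveOrigin X →
      Ω.IsDLocOrigin D.toDLocContext → letI := D.catK; letI := DLocObj.dlocCategory X;
        ∀ (Z : D.DLocK) (j : (D.pi1Functor.obj Z).J),
          (D.curve Z).aug (D.objIso Z j) = (D.pi1Functor.obj Z).augJ j)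
    (hdict : ∀ (X : TemperedCurve p) (D : DLocSchemeData X), Ω.IsHyperbolicCurveOrigin X →
      Ω.IsDLocOrigin D.toDLocContext → letI := D.catK; ∀ Z Z' : D.DLocK,
        ∃ (C : TemperedCurveHom p (D.curve Z) (D.curve Z')) (ι : (Z ⟶ Z') → C.DomHom),
          Ω.IsDomHomOrigin C ∧ Function.Injective ι ∧ (∀ f : Z ⟶ Z', C.pi1 (ι f) = D.pi1 f) ∧
            ∀ f : C.DomHom, (∃ g ∈ X.GK, ∀ x,
              (D.curve Z').aug (C.pi1 f x) = g * (D.curve Z).aug x * g⁻¹) → f ∈ Set.range ι)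
    (hL02 : ∀ (X : TemperedCurve p) (D : DLocSchemeData X), Ω.IsHyperbolicCurveOrigin X →
      Ω.IsDLocOrigin D.toDLocContext → ObjectsHitOnTheNose X D)
    (hB4 : ∀ (X : TemperedCurve p) (D : DLocSchemeData X), Ω.IsHyperbolicCurveOrigin X →
      Ω.IsDLocOrigin D.toDLocContext → CuspImageOpenInDecomp X D)
    (hB1 : ∀ X : TemperedCurve p, Ω.IsHyperbolicCurveOrigin X → DecompCompact X)
    (h65 : Ω.CuspidalAbsolutenessHolds) (h65i : Ω.TemperedDecompositionGroupsHolds)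
    (hΔ : ∀ X Y : TemperedCurve p, Ω.IsHyperbolicCurveOrigin X → Ω.IsHyperbolicCurveOrigin Y →
      ∀ α : X.PiTemp ≃ₜ* Y.PiTemp, X.DeltaTemp.map α.toMulEquiv.toMonoidHom = Y.DeltaTemp) :
    Ω.DLocGroupTheoreticityGenuineHolds :=
  Ω.dlocGroupTheoreticityGenuineHolds_of_parts hcurve hL02
    (Ω.piFunctorBijectiveOnHom_of_temperedAnabelianTheoremHolds h64 hcurve hK haug hdict) hB4 hB1 h65
    h65i hΔ

/-- **[SemiAnbd] Thm. 6.8 (i)(ii) as printed (F-1681), REDUCED to named leaves WITH THE MORPHISM HALF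
DERIVED FROM Thm. 6.4**: the closer of record `dlocGroupTheoreticityHolds_of_parts` with `hL04` REPLACED
by [SemiAnbd] Thm. 6.4 as printed (F-1693, BY NAME) + the `K`-morphism dictionary at certified data.
Nothing of [SemiAnbd]/[GalSect] is asserted.
[cite: MochizukiSemiAnbd2006, Thm 6.8(i)-(ii) pp.74-75] [cite: MochizukiGalSect2005, Thm 2.3 p.9] -/
theorem dlocGroupTheoreticityHolds_of_parts_of_thm64 (Ω : TemperedMorphismOrigin p)
    (hgen : ∀ (X : TemperedCurve p) (DX : DLocContext X), Ω.IsHyperbolicCurveOrigin X →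
      Ω.IsDLocOrigin DX → ∃ D : DLocSchemeData X, D.toDLocContext = DX)
    (h64 : Ω.TemperedAnabelianTheoremHolds)
    (hcurve : ∀ (X : TemperedCurve p) (D : DLocSchemeData X) (Z : D.DLocK),
      Ω.IsHyperbolicCurveOrigin X → Ω.IsDLocOrigin D.toDLocContext →
        Ω.IsHyperbolicCurveOrigin (D.curve Z))
    (hK : ∀ (X : TemperedCurve p) (D : DLocSchemeData X) (Z : D.DLocK),
      Ω.IsHyperbolicCurveOrigin X → Ω.IsDLocOrigin D.toDLocContext → X.K ≤ (D.curve Z).K)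
    (haug : ∀ (X : TemperedCurve p) (D : DLocSchemeData X), Ω.IsHyperbolicCurveOrigin X →
      Ω.IsDLocOrigin D.toDLocContext → letI := D.catK; letI := DLocObj.dlocCategory X;
        ∀ (Z : D.DLocK) (j : (D.pi1Functor.obj Z).J),
          (D.curve Z).aug (D.objIso Z j) = (D.pi1Functor.obj Z).augJ j)
    (hdict : ∀ (X : TemperedCurve p) (D : DLocSchemeData X), Ω.IsHyperbolicCurveOrigin X →
      Ω.IsDLocOrigin D.toDLocContext → letI := D.catK; ∀ Z Z' : D.DLocK,
        ∃ (C : TemperedCurveHom p (D.curve Z) (D.curve Z')) (ι : (Z ⟶ Z') → C.DomHom),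
          Ω.IsDomHomOrigin C ∧ Function.Injective ι ∧ (∀ f : Z ⟶ Z', C.pi1 (ι f) = D.pi1 f) ∧
            ∀ f : C.DomHom, (∃ g ∈ X.GK, ∀ x,
              (D.curve Z').aug (C.pi1 f x) = g * (D.curve Z).aug x * g⁻¹) → f ∈ Set.range ι)
    (hL02 : ∀ (X : TemperedCurve p) (D : DLocSchemeData X), Ω.IsHyperbolicCurveOrigin X →
      Ω.IsDLocOrigin D.toDLocContext → ObjectsHitOnTheNose X D)
    (hB4 : ∀ (X : TemperedCurve p) (D : DLocSchemeData X), Ω.IsHyperbolicCurveOrigin X →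
      Ω.IsDLocOrigin D.toDLocContext → CuspImageOpenInDecomp X D)
    (hB1 : ∀ X : TemperedCurve p, Ω.IsHyperbolicCurveOrigin X → DecompCompact X)
    (h65 : Ω.CuspidalAbsolutenessHolds) (h65i : Ω.TemperedDecompositionGroupsHolds)
    (hΔ : ∀ X Y : TemperedCurve p, Ω.IsHyperbolicCurveOrigin X → Ω.IsHyperbolicCurveOrigin Y →
      ∀ α : X.PiTemp ≃ₜ* Y.PiTemp, X.DeltaTemp.map α.toMulEquiv.toMonoidHom = Y.DeltaTemp) :
    Ω.DLocGroupTheoreticityHolds :=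
  Ω.dlocGroupTheoreticityHolds_of_genuine hgen
    (Ω.dlocGroupTheoreticityGenuineHolds_of_parts_of_thm64 h64 hcurve hK haug hdict hL02 hB4 hB1 h65
      h65i hΔ)

end TemperedMorphismOrigin

end Literature.AnabelianGeometry.SemiGraphs
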